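import Literature.IUT.HodgeTheaters.TemperedCoveringsCor23viHatCuspIncidenceReduction
import Literature.IUT.HodgeTheaters.TemperedCoveringsCor23viGraphIncidence
import Literature.AnabelianGeometry.SemiGraphs.NodNonEdgeVerticialIncidenceProofs
import HarnessLib

/-!
# [IUTchI] Cor. 2.3 (vi) at the genuine 𝔛-datum: the pro-`Σ̂` incidence residual `hF` BY NAME over abc-iut-L3's
# [NodNon] Lem. 1.7 predicate `PSCDatum.EdgeVerticialAbutment` of the generized pro-`Σ̂` PSC datum (row R41)

S. Mochizuki, *Inter-universal Teichmüller theory I: construction of Hodge theaters*, kurims manuscript (May 2020),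
§2, Corollary 2.3 (vi) p. 48 l. 6–16, proof p. 49 l. 62–64 ("Assertion (vi) follows immediately from a similar
argument to the argument applied in the proof of [CombGC], Proposition 1.5, (i), by passing to pro-`Σ` completions")
[cite: Mochizuki2012, Cor 2.3(vi) pp.48-49] (D-0012 claim key; series status DISPUTED; nothing of the series is asserted
here — PROVED below are implications between statements about the tree's own objects);
Y. Hoshi, S. Mochizuki, *On the combinatorial anabelian geometry of nodally nondegenerate outer representations*,
Hiroshima Math. J. **41** (2011), Lemma 1.7 p. 290 (kurims ms p. 17: "`ẽ ∈ ℰ(ṽ)` ⟺ `Π_ṽ ∩ Π_ẽ ≠ {1}`; in particular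
… `Π_ẽ ⊆ Π_ṽ`") [cite: HoshiMochizukiNodNon2011, Lem 1.7 p.290]; Y. Hoshi, S. Mochizuki, *Topics surrounding the
combinatorial anabelian geometry of hyperbolic curves I*, Adv. Stud. Pure Math. **63** (2012), Def. 2.8 (the
generization `𝒢⇝S`: the sub-semi-graph `ℍ` is contracted to ONE vertex `v_ℍ`, the edges not inside `ℍ` are kept) and
Prop. 2.9 (i) p. 44 (the specialization outer isomorphism `Φ_{𝒢⇝S} : Π_{𝒢⇝S} ⥲ Π_𝒢` induces a bijection of cuspidal /
edge-like subgroups and carries the verticial subgroup `Π_{v_ℍ}` onto the image of `Π_{𝒢|_ℍ}`)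
[cite: HoshiMochizukiCbTpI2012, Prop 2.9(i) p.44]; S. Mochizuki, *Semi-graphs of anabelioids*, Publ. RIMS **42**
(2006), Thm. 3.7 (iii) p. 41 [cite: MochizukiSemiAnbd2006, Thm 3.7(iii) p.41].

PROOF-ONLY file (abc-iut cell, seat abc-iut-w4-d070 gen 12, L5 ROWS #6 row R41 «COR23VI-HF-BY-NAME-OVER-L3»; cone row
`IUTchI:Cor2.3(vi)`; no definition, no instance, no new `Prop` fact).  Consumed BY NAME, never edited or restated:
abc-iut-w5-d174's [NodNon] Lem. 1.7 predicates `PSCDatum.EdgeVerticialAbutment` / `PSCDatum.EdgeVerticialContainment`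
and `PSCSemiGraph.Abuts` (`NodNonEdgeVerticialIncidence.lean`, p493760) with the consequence
`PSCDatum.abuts_of_inf_ne_bot` (`…Proofs.lean`, p494004); abc-iut-w4-d059's reductions
`hhatH_of_hatEdgeIncidence_of_cuspEdgeDict` / `cor23vi_ofSpecialFibre_closureH_of_piData_of_hatEdgeIncidence`
(p492945) and `hhatH_of_hatCuspIncidence_of_cuspOpenEdgeDict` / `…_of_piData_of_hatCuspIncidence` (p493690);
abc-iut-L5-d5's group-form closers `cor23vi_ofSpecialFibre_verticialOver_of_mem_decompSubgroups` /
`…_verticialOver_piDataTpH` (p493882); this lineage's `hcusp_of_edgeLike` (p490241).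

WHAT WAS OPEN.  After p492945/p493690/p493882 the node's open content at the genuine datum `ofSpecialFibre …` is ONE
origin-free profinite law: `hF` (GAP-LEDGER G-w4d059-g8-1; cusp-only twin `hFcusp`; group form `hhatV`) — «an edge-like
subgroup `L` of the edge `e` of `𝔾^c` with `ι(L) ⊆ g · Π̂_ℍ · g⁻¹`, `Π̂_ℍ := closure ι(Π^tp_ℍ)`, forces `e` to abut to
a vertex of `ℍ`» — displayed as an UNNAMED `∀`-hypothesis (FACT-LIST candidate).  In print (p. 49 l. 62–64 read with
[CbTpI] Prop. 2.9 (i) and [NodNon] Lem. 1.7) it is the composite of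
  (G) GENERIZATION: pass to `𝒢⇝ℍ`, a semi-graph of anabelioids of pro-`Σ̂` PSC-type on the profinite completion
      `Π̂_𝔾`, in which `Π̂_ℍ` IS the verticial subgroup at the new vertex `v_ℍ` and the edges of `𝔾` outside `ℍ` keep
      their (completed) edge-like subgroups; and
  (L) [NodNon] Lem. 1.7 for that PSC-type datum: `h Π_e h⁻¹ ⊆ g Π_{v_ℍ} g⁻¹ ⇒ e` abuts `v_ℍ`.
THIS FILE writes `hF` EXACTLY SO, BY NAME: (L) is abc-iut-L3's NAMED predicate `Q.EdgeVerticialAbutment` of a displayed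
datum `Q : PSCDatum Π̂_𝔾` (the generized datum — DATA of ORIGIN class, not constructed in the tree), and (G) is the
displayed ORIGIN DICTIONARY between `Q` and the tempered chart: (g1) «a conjugate of `Q.vertGp v_ℍ` is `Π̂_ℍ`»
([CbTpI] Prop. 2.9 (i)(3) through abc-iut-L3's `Π̂_ℍ = closure ι(Π^tp_ℍ)`), (g2) «the `ι`-image of every edge-like
subgroup of `𝔾` at `e` is a `Q`-edge-like subgroup of an edge `e′` of `𝒢⇝ℍ` which abuts `v_ℍ` only if `e` abuts a
vertex of `ℍ`» (Prop. 2.9 (i)(1)–(2) + the bookkeeping of Def. 2.8).  Then: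

* `hatEdgeIncidence_of_pscAbutment` — **`hF` ⟸ `Q.EdgeVerticialAbutment` + (g1) + (g2)** (chart level, any `ι`);
  `hatEdgeIncidence_of_pscContainment_of_pscAbutment` — the variant with «`⊆`» instead of «`=`» in (g2), from
  `EdgeVerticialContainment ∧ EdgeVerticialAbutment` (`abuts_of_inf_ne_bot`) for edge-like subgroups with `ι(L) ≠ 1`;
  `hatCuspIncidence_of_pscAbutment` — the OPEN-edge (cusp-only) twin feeding p493690's `hFcusp`;
* `hatIncidence_verticialOver_of_hatEdgeIncidence_of_cuspEdgeLike` — abc-iut-L5-d5's group-form law `hhatV` ⟸ `hF` +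
  «`J_x` is edge-like for SOME edge» (NO vertex assignment needed: [SemiAnbd] Thm. 3.7 (iii), `hcusp_of_edgeLike`);
* one-call closers of row `IUTchI:Cor2.3(vi)` AT THE GENUINE DATUM over these inputs:
  `cor23vi_ofSpecialFibre_verticialOver_of_mem_decompSubgroups_of_pscAbutment` (group-form atom, general connected `ℍ`
  with a vertex, every `Π^tp_ℍ ∈ decompSubgroups ℍ`; binders `Q`, `v_ℍ`, `Q.EdgeVerticialAbutment`, (g1), (g2),
  `hJe`), `cor23vi_ofSpecialFibre_verticialOver_piDataTpH_of_pscAbutment` (over abc-iut-L3's origin record, `Π^tp_ℍ :=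
  P.TpH`), and `cor23vi_ofSpecialFibre_closureH_of_piData_of_pscAbutment` (print's record-vertex cusp predicate, binders
  + `hdict`).

## BINDER CENSUS TABLE (L5-lead RULINGS #101 (2) format; classes DATA · DATUM-INTERNAL · NAMED-L3-PREDICATE · ORIGIN)

| binder | class | what it is in print |
|---|---|---|
| `X d S Σ Σ̂ hsub hne hprime hp H TpH hTpH hconn hv` / `P` | DATA / DATUM-INTERNAL | as in p490241 / p492945 / p493882 |
| `h36 : S.Gc.Prop36Hypotheses` | DATUM-INTERNAL | names the completion `ι : Π^tp_𝔾 ↪ Π̂_𝔾` |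
| `Q : PSCDatum Π̂_𝔾`, `vH : Q.graph.V` | DATA (ORIGIN class) | the generization `𝒢⇝ℍ` of [CbTpI] Def. 2.8 as a semi-graph of anabelioids of pro-`Σ̂` PSC-type with fundamental group `Π̂_𝔾` ([IUTchI] p. 44 l. 13–31: `𝔾`, `ℍ` of pro-`Σ` PSC-type, `Π̂_𝔾` its pro-`Σ̂` fundamental group), recorded through abc-iut-L3's interface `PSCDatum` ([CombGC] Def. 1.1 (ii)); NOT constructed in the tree (FOUNDATIONS rows 13–14) |
| `hAb : Q.EdgeVerticialAbutment` (and `hCt : Q.EdgeVerticialContainment` in the «`⊆`» variant) | NAMED L3 PREDICATE | [NodNon] Lem. 1.7 (ii) ⇒ (i) (resp. its "in particular" clause) for `𝒢⇝ℍ` — abc-iut-w5-d174's typed predicates (p493760), INSTANCE-PROVED at abc-iut-L3's genuine carriers (p494004 ff.); as a `∀` over data of PSC-type it is the printed lemma (origin parameter `Ω.IsOfPSCType`) |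
| `hvH` (g1) | ORIGIN dictionary | [CbTpI] Prop. 2.9 (i)(3): `Φ_{𝒢⇝ℍ}` carries `Π_{v_ℍ}` onto the image of `Π_{𝒢|_ℍ}`; with abc-iut-L3's `Π̂_ℍ = closure ι(Π^tp_ℍ)` ([IUTchI] p. 44 l. 39–44) |
| `hE` / `hEopen` (g2) | ORIGIN dictionary | [CbTpI] Prop. 2.9 (i)(1)–(2): cuspidal / edge-like subgroups of `𝒢` outside `ℍ` correspond to those of `𝒢⇝ℍ`; Def. 2.8: an edge of `𝒢⇝ℍ` abuts `v_ℍ` iff the corresponding edge of `𝒢` abuts a vertex of `ℍ` (for edges INSIDE `ℍ` the conclusion of `hF` holds outright, so (g2) may send them anywhere) |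
| `hJe` : `J_x` is edge-like for some edge / `hdict`, `hdictO` | ORIGIN dictionary | cusps of `X_K` ↔ open edges of `G^c` ([SemiAnbd] Ex. 3.10, §6 p. 71); `hdict`/`hdictO` as in p492945 / p493690 (GAP G-w4d070-g11-1) |

COUNTS (main closers): NAMED-L3-PREDICATE 1 (`hAb`) · ORIGIN dictionary 3 (`hvH`, `hE`, `hJe` or `hdict`) · DATA `Q vH` ·
FACT-INSTANCE 0 · no unnamed `∀`-law.  HONEST FRAMING: this is a BY-NAME RESTATEMENT — no new mathematics: the content of
`hF` is redistributed into abc-iut-L3's named [NodNon] predicate on a DISPLAYED generized datum plus the [CbTpI] Prop. 2.9 (i)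
dictionary, both of origin class; the proofs are compositions.  Model-RELATIVE (the genuine datum `ofSpecialFibre`); typed ≠
discharged for the [IUTchI] claim keys; nothing here bears on [IUTchIII] Cor. 3.12 or asserts that abc is proved or refuted.
-/

noncomputable section

namespace Literature.IUT.HodgeTheaters

open _root_.Topology
open scoped Pointwise
open Literature.AnabelianGeometry.SemiGraphs
open Literature.AnabelianGeometry.SemiGraphs.ProfiniteSemiGraph

universe u v

namespace StableCurveTemperedData

/-! ### 1. Chart level: `hF` from [NodNon] Lem. 1.7 for a pro-`Σ̂` PSC datum on the completion + the generization dictionary -/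

section Chart

variable {𝒢 : ProfiniteSemiGraph.{u}} (c : TemperedPiChart 𝒢) {Ghat : Type v} [Group Ghat] [TopologicalSpace Ghat]
  [IsTopologicalGroup Ghat]
  (ι : c.G →* Ghat) (H : 𝒢.graph.Subgraph) (TpH : Subgroup c.G) (Q : PSCDatum Ghat) (vH : Q.graph.V)

/-- **Pro-`Σ̂` edge–subgraph incidence `hF` (G-w4d059-g8-1) ⟸ [NodNon] Lem. 1.7 `EdgeVerticialAbutment` of the generized
PSC datum `Q` on the completion + the [CbTpI] Prop. 2.9 (i) dictionary** (g1) «a conjugate of `Q.vertGp v_ℍ` is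
`Π̂_ℍ := closure ι(Π^tp_ℍ)`», (g2) «`ι(L)` is a `Q`-edge-like subgroup of an edge abutting `v_ℍ` only if `e` abuts a vertex
of `ℍ`».  Chart level, any `ι`. [cite: HoshiMochizukiNodNon2011, Lem 1.7 p.290] -/
theorem hatEdgeIncidence_of_pscAbutment (hAb : Q.EdgeVerticialAbutment)
    (hvH : ∃ γ : Ghat, MulAut.conj γ • Q.vertGp vH = (TpH.map ι).topologicalClosure)
    (hE : ∀ e : 𝒢.graph.Edge, ∀ L ∈ edgeLikeSubgroups c e, ∃ e' : Q.graph.N ⊕ Q.graph.C, ∃ h : Ghat,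
      L.map ι = MulAut.conj h • Q.edgeGp e' ∧
        (Q.graph.Abuts e' vH → ∃ b : 𝒢.graph.Branch, 𝒢.graph.edgeOf b = e ∧ ∃ w ∈ H.verts, 𝒢.graph.abuts b = some w)) :
    ∀ e : 𝒢.graph.Edge, ∀ L ∈ edgeLikeSubgroups c e, ∀ g : Ghat,
      L.map ι ≤ MulAut.conj g • (TpH.map ι).topologicalClosure →
        ∃ b : 𝒢.graph.Branch, 𝒢.graph.edgeOf b = e ∧ ∃ w ∈ H.verts, 𝒢.graph.abuts b = some w := by
  intro e L hL g hg
  obtain ⟨e', h, hLe, habut⟩ := hE e L hL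
  obtain ⟨γ, hγ⟩ := hvH
  refine habut (hAb vH e' (g * γ) h ?_)
  rw [← hLe, map_mul, mul_smul, hγ]
  exact hg

/-- **The «`⊆`» variant**: if (g2) only places `ι(L)` INSIDE a `Q`-edge-like subgroup, `hF` follows for the edge-like
subgroups with `ι(L) ≠ 1` from BOTH clauses of [NodNon] Lem. 1.7 (`EdgeVerticialContainment`: `Π_ṽ ∩ Π_ẽ ≠ {1} ⇒ Π_ẽ ⊆ Π_ṽ`,
then `EdgeVerticialAbutment`; abc-iut-w5-d174's `abuts_of_inf_ne_bot`). [cite: HoshiMochizukiNodNon2011, Lem 1.7 p.290] -/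
theorem hatEdgeIncidence_of_pscContainment_of_pscAbutment (hCt : Q.EdgeVerticialContainment)
    (hAb : Q.EdgeVerticialAbutment)
    (hvH : ∃ γ : Ghat, MulAut.conj γ • Q.vertGp vH = (TpH.map ι).topologicalClosure)
    (hE : ∀ e : 𝒢.graph.Edge, ∀ L ∈ edgeLikeSubgroups c e, ∃ e' : Q.graph.N ⊕ Q.graph.C, ∃ h : Ghat,
      L.map ι ≤ MulAut.conj h • Q.edgeGp e' ∧
        (Q.graph.Abuts e' vH → ∃ b : 𝒢.graph.Branch, 𝒢.graph.edgeOf b = e ∧ ∃ w ∈ H.verts, 𝒢.graph.abuts b = some w)) :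
    ∀ e : 𝒢.graph.Edge, ∀ L ∈ edgeLikeSubgroups c e, L.map ι ≠ ⊥ → ∀ g : Ghat,
      L.map ι ≤ MulAut.conj g • (TpH.map ι).topologicalClosure →
        ∃ b : 𝒢.graph.Branch, 𝒢.graph.edgeOf b = e ∧ ∃ w ∈ H.verts, 𝒢.graph.abuts b = some w := by
  intro e L hL hL1 g hg
  obtain ⟨e', h, hLe, habut⟩ := hE e L hL
  obtain ⟨γ, hγ⟩ := hvH
  refine habut (PSCDatum.abuts_of_inf_ne_bot Q hCt hAb (g := g * γ) (h := h) ?_)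
  rw [map_mul, mul_smul, hγ]
  exact fun h0 => hL1 (le_bot_iff.mp (h0 ▸ le_inf hg hLe))

/-- **Cusp-only (OPEN-edge) twin** feeding abc-iut-w4-d059's `hFcusp` (p493690): the dictionary (g2) is asked only of the
open edges of `𝔾`. [cite: HoshiMochizukiNodNon2011, Lem 1.7 p.290] -/
theorem hatCuspIncidence_of_pscAbutment (hAb : Q.EdgeVerticialAbutment)
    (hvH : ∃ γ : Ghat, MulAut.conj γ • Q.vertGp vH = (TpH.map ι).topologicalClosure)
    (hEopen : ∀ e : 𝒢.graph.Edge, (∃ b₀ : 𝒢.graph.Branch, 𝒢.graph.edgeOf b₀ = e ∧ 𝒢.graph.abuts b₀ = none) →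
      ∀ L ∈ edgeLikeSubgroups c e, ∃ e' : Q.graph.N ⊕ Q.graph.C, ∃ h : Ghat,
        L.map ι = MulAut.conj h • Q.edgeGp e' ∧
          (Q.graph.Abuts e' vH → ∃ b : 𝒢.graph.Branch, 𝒢.graph.edgeOf b = e ∧ ∃ w ∈ H.verts, 𝒢.graph.abuts b = some w)) :
    ∀ e : 𝒢.graph.Edge, (∃ b₀ : 𝒢.graph.Branch, 𝒢.graph.edgeOf b₀ = e ∧ 𝒢.graph.abuts b₀ = none) →
      ∀ L ∈ edgeLikeSubgroups c e, ∀ g : Ghat,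
        L.map ι ≤ MulAut.conj g • (TpH.map ι).topologicalClosure →
          ∃ b : 𝒢.graph.Branch, 𝒢.graph.edgeOf b = e ∧ ∃ w ∈ H.verts, 𝒢.graph.abuts b = some w := by
  intro e he L hL g hg
  obtain ⟨e', h, hLe, habut⟩ := hEopen e he L hL
  obtain ⟨γ, hγ⟩ := hvH
  refine habut (hAb vH e' (g * γ) h ?_)
  rw [← hLe, map_mul, mul_smul, hγ]
  exact hg

end Chart

/-! ### 2. The group-form law `hhatV` from `hF` and cusp edge-likeness alone -/

section Rows

variable {p : ℕ} [Fact p.Prime] (X : TemperedCurve p) (d : X.GroupLevelData)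
  (S : SpecialFibreData (X.toTemperedArithmeticGroup d)) (h36 : S.Gc.Prop36Hypotheses)
  (Sigma SigmaHat : Set ℕ) (hsub : Sigma ⊆ SigmaHat) (hne : Sigma.Nonempty)
  (hprime : ∀ q ∈ SigmaHat, q.Prime) (hp : p ∉ Sigma)
  (TpH : Subgroup S.chart.G)

include h36 in
/-- **abc-iut-L5-d5's group-form residual `hhatV` ⟸ `hF` + «`J_x` is edge-like for SOME edge of `𝔾^c`»** — no cusp ↦
vertex assignment is needed: the branch produced by `hF` abuts a vertex `w ∈ ℍ`, and an edge-like subgroup lies in a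
verticial subgroup of every abutting vertex ([SemiAnbd] Thm. 3.7 (iii), this lineage's `hcusp_of_edgeLike`).
[cite: MochizukiSemiAnbd2006, Thm 3.7(iii) p.41] -/
theorem hatIncidence_verticialOver_of_hatEdgeIncidence_of_cuspEdgeLike {H : S.Gc.graph.Subgraph}
    (hF : ∀ (e : S.Gc.graph.Edge), ∀ L ∈ edgeLikeSubgroups S.chart e,
      ∀ g : (TemperedGraphGroupData.exists_completion_of_prop36 S.Gc h36 S.chart).choose,
        L.map (TemperedGraphGroupData.exists_completion_of_prop36 S.Gc h36 S.chart).choose_spec.choose.toMonoidHom ≤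
          MulAut.conj g • (TpH.map (TemperedGraphGroupData.exists_completion_of_prop36 S.Gc h36
            S.chart).choose_spec.choose.toMonoidHom).topologicalClosure →
        ∃ b : S.Gc.graph.Branch, S.Gc.graph.edgeOf b = e ∧ ∃ w ∈ H.verts, S.Gc.graph.abuts b = some w)
    (hJe : ∀ x : {x : X.Pt // X.IsCusp x}, ∃ e : S.Gc.graph.Edge,
      ((X.inertia x.1).subgroupOf (X.toTemperedArithmeticGroup d).delta).map S.admissible.toMonoidHom ∈
        edgeLikeSubgroups S.chart e) :
    ∀ x : {x : X.Pt // X.IsCusp x},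
      (∃ g : (TemperedGraphGroupData.exists_completion_of_prop36 S.Gc h36 S.chart).choose,
        (((X.inertia x.1).subgroupOf (X.toTemperedArithmeticGroup d).delta).map S.admissible.toMonoidHom).map
            (TemperedGraphGroupData.exists_completion_of_prop36 S.Gc h36 S.chart).choose_spec.choose.toMonoidHom ≤
          MulAut.conj g • (TpH.map (TemperedGraphGroupData.exists_completion_of_prop36 S.Gc h36
            S.chart).choose_spec.choose.toMonoidHom).topologicalClosure) →
      ∃ v ∈ H.verts, ∃ K ∈ verticialSubgroups S.chart v,
        ((X.inertia x.1).subgroupOf (X.toTemperedArithmeticGroup d).delta).map S.admissible.toMonoidHom ≤ K := by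
  intro x hx
  obtain ⟨g, hg⟩ := hx
  obtain ⟨e, hJ⟩ := hJe x
  obtain ⟨b, hbe, w, hwH, hbw⟩ := hF e _ hJ g hg
  subst hbe
  exact ⟨w, hwH, hcusp_of_edgeLike X d S h36 (fun _ => w) x ⟨b, hbw, _, hJ, le_rfl⟩⟩

/-! ### 3. One-call closers of row `IUTchI:Cor2.3(vi)` at the genuine datum over the NAMED L3 predicate -/

/-- **Row `IUTchI:Cor2.3(vi)` at the genuine 𝔛-datum, GROUP-form atom, for EVERY `Π^tp_ℍ := TpH ∈ decompSubgroups S.chart ℍ`,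
general connected `ℍ` with a vertex, print's `Π̂_ℍ`** — binders: the generized pro-`Σ̂` PSC datum `Q` on `Π̂_𝔾` with its
vertex `v_ℍ` (DATA), abc-iut-L3's NAMED predicate `Q.EdgeVerticialAbutment` ([NodNon] Lem. 1.7), the [CbTpI] Prop. 2.9 (i)
dictionary (g1) (g2), and «`J_x` edge-like for some edge».  abc-iut-L5-d5's `cor23vi_ofSpecialFibre_verticialOver_of_mem_decompSubgroups`
with `hhatV` so supplied.  FQ type per the gate rule. [cite: Mochizuki2012, Cor 2.3(vi) pp.48-49] [claim: Mochizuki2012, status: disputed] -/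
theorem cor23vi_ofSpecialFibre_verticialOver_of_mem_decompSubgroups_of_pscAbutment {H : S.Gc.graph.Subgraph}
    (hTpH : TpH ∈ S.chart.decompSubgroups H) (hconn : (S.Gc.restrict H).IsConnected)
    (hv : (S.Gc.restrict H).HasVertex)
    (Q : PSCDatum (TemperedGraphGroupData.exists_completion_of_prop36 S.Gc h36 S.chart).choose) (vH : Q.graph.V)
    (hAb : Q.EdgeVerticialAbutment)
    (hvH : ∃ γ : (TemperedGraphGroupData.exists_completion_of_prop36 S.Gc h36 S.chart).choose,
      MulAut.conj γ • Q.vertGp vH = (TpH.map (TemperedGraphGroupData.exists_completion_of_prop36 S.Gc h36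
        S.chart).choose_spec.choose.toMonoidHom).topologicalClosure)
    (hE : ∀ e : S.Gc.graph.Edge, ∀ L ∈ edgeLikeSubgroups S.chart e, ∃ e' : Q.graph.N ⊕ Q.graph.C,
      ∃ h : (TemperedGraphGroupData.exists_completion_of_prop36 S.Gc h36 S.chart).choose,
        L.map (TemperedGraphGroupData.exists_completion_of_prop36 S.Gc h36 S.chart).choose_spec.choose.toMonoidHom =
          MulAut.conj h • Q.edgeGp e' ∧
        (Q.graph.Abuts e' vH → ∃ b : S.Gc.graph.Branch, S.Gc.graph.edgeOf b = e ∧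
          ∃ w ∈ H.verts, S.Gc.graph.abuts b = some w))
    (hJe : ∀ x : {x : X.Pt // X.IsCusp x}, ∃ e : S.Gc.graph.Edge,
      ((X.inertia x.1).subgroupOf (X.toTemperedArithmeticGroup d).delta).map S.admissible.toMonoidHom ∈
        edgeLikeSubgroups S.chart e) :
    Literature.IUT.HodgeTheaters.StableCurveTemperedData.Cor23vi
        (ofSpecialFibre X d S h36 Sigma SigmaHat hsub hne hprime hp TpH ((TpH.map
          (TemperedGraphGroupData.exists_completion_of_prop36 S.Gc h36 S.chart).choose_spec.choose.toMonoidHom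
          ).topologicalClosure) (Subgroup.le_topologicalClosure _)
          (fun x => ∃ v ∈ H.verts, ∃ K ∈ verticialSubgroups S.chart v,
            ((X.inertia x.1).subgroupOf (X.toTemperedArithmeticGroup d).delta).map S.admissible.toMonoidHom ≤ K)) :=
  cor23vi_ofSpecialFibre_verticialOver_of_mem_decompSubgroups X d S h36 Sigma SigmaHat hsub hne hprime hp TpH hTpH hconn hv
    (hatIncidence_verticialOver_of_hatEdgeIncidence_of_cuspEdgeLike X d S h36 TpH
      (hatEdgeIncidence_of_pscAbutment S.chart _ H TpH Q vH hAb hvH hE) hJe)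

end Rows

/-! ### 4. Over abc-iut-L3's origin record `SpecialFibreTower.PiData` (`ℍ := P.H`) -/

section PiData

variable {p : ℕ} [Fact p.Prime] (X : TemperedCurve p) (d : X.GroupLevelData)
  (S : SpecialFibreData (X.toTemperedArithmeticGroup d)) (h36 : S.Gc.Prop36Hypotheses)
  (Sigma SigmaHat : Set ℕ) (hsub : Sigma ⊆ SigmaHat) (hne : Sigma.Nonempty)
  (hprime : ∀ q ∈ SigmaHat, q.Prime) (hp : p ∉ Sigma)
  (TpH : Subgroup S.chart.G)
  {T : SpecialFibreTower X.DeltaTemp} (P : SpecialFibreTower.PiData X d S T)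

/-- **Row `IUTchI:Cor2.3(vi)` over the origin record with the RECORD'S `Π^tp_ℍ := P.TpH`, GROUP-form atom** — binders:
`Q`, `v_ℍ`, `Q.EdgeVerticialAbutment` (NAMED, [NodNon] Lem. 1.7), dictionary (g1) (g2) at `P.TpH`, `hJe`.  abc-iut-L5-d5's
`cor23vi_ofSpecialFibre_verticialOver_piDataTpH` with `hhatV` so supplied.  FQ type per the gate rule.
[cite: Mochizuki2012, Cor 2.3(vi) pp.48-49] [claim: Mochizuki2012, status: disputed] -/
theorem cor23vi_ofSpecialFibre_verticialOver_piDataTpH_of_pscAbutment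
    (Q : PSCDatum (TemperedGraphGroupData.exists_completion_of_prop36 S.Gc h36 S.chart).choose) (vH : Q.graph.V)
    (hAb : Q.EdgeVerticialAbutment)
    (hvH : ∃ γ : (TemperedGraphGroupData.exists_completion_of_prop36 S.Gc h36 S.chart).choose,
      MulAut.conj γ • Q.vertGp vH = (P.TpH.map (TemperedGraphGroupData.exists_completion_of_prop36 S.Gc h36
        S.chart).choose_spec.choose.toMonoidHom).topologicalClosure)
    (hE : ∀ e : S.Gc.graph.Edge, ∀ L ∈ edgeLikeSubgroups S.chart e, ∃ e' : Q.graph.N ⊕ Q.graph.C,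
      ∃ h : (TemperedGraphGroupData.exists_completion_of_prop36 S.Gc h36 S.chart).choose,
        L.map (TemperedGraphGroupData.exists_completion_of_prop36 S.Gc h36 S.chart).choose_spec.choose.toMonoidHom =
          MulAut.conj h • Q.edgeGp e' ∧
        (Q.graph.Abuts e' vH → ∃ b : S.Gc.graph.Branch, S.Gc.graph.edgeOf b = e ∧
          ∃ w ∈ P.H.verts, S.Gc.graph.abuts b = some w))
    (hJe : ∀ x : {x : X.Pt // X.IsCusp x}, ∃ e : S.Gc.graph.Edge,
      ((X.inertia x.1).subgroupOf (X.toTemperedArithmeticGroup d).delta).map S.admissible.toMonoidHom ∈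
        edgeLikeSubgroups S.chart e) :
    Literature.IUT.HodgeTheaters.StableCurveTemperedData.Cor23vi
        (ofSpecialFibre X d S h36 Sigma SigmaHat hsub hne hprime hp P.TpH ((P.TpH.map
          (TemperedGraphGroupData.exists_completion_of_prop36 S.Gc h36 S.chart).choose_spec.choose.toMonoidHom
          ).topologicalClosure) (Subgroup.le_topologicalClosure _)
          (fun x => ∃ v ∈ P.H.verts, ∃ K ∈ verticialSubgroups S.chart v,
            ((X.inertia x.1).subgroupOf (X.toTemperedArithmeticGroup d).delta).map S.admissible.toMonoidHom ≤ K)) :=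
  cor23vi_ofSpecialFibre_verticialOver_piDataTpH X d S h36 Sigma SigmaHat hsub hne hprime hp P
    (hatIncidence_verticialOver_of_hatEdgeIncidence_of_cuspEdgeLike X d S h36 P.TpH
      (hatEdgeIncidence_of_pscAbutment S.chart _ P.H P.TpH Q vH hAb hvH hE) hJe)

/-- **Row `IUTchI:Cor2.3(vi)` over the origin record with PRINT'S record-vertex cusp predicate `x ↦ (P.proj i)(P.vtxOfCusp i x) ∈ ℍ`,
print's `Π^tp_ℍ := TpH ∈ decompSubgroups S.chart P.H`** — binders: `Q`, `v_ℍ`, `Q.EdgeVerticialAbutment` (NAMED, [NodNon]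
Lem. 1.7), dictionary (g1) (g2), and abc-iut-w4-d059's cusp ↦ open-edge dictionary `hdict` (GAP G-w4d070-g11-1).
abc-iut-w4-d059's `cor23vi_ofSpecialFibre_closureH_of_piData_of_hatEdgeIncidence` with `hF` so supplied.  FQ type per the
gate rule. [cite: Mochizuki2012, Cor 2.3(vi) pp.48-49] [claim: Mochizuki2012, status: disputed] -/
theorem cor23vi_ofSpecialFibre_closureH_of_piData_of_pscAbutment (i : ℕ)
    (hTpH : TpH ∈ S.chart.decompSubgroups P.H)
    (Q : PSCDatum (TemperedGraphGroupData.exists_completion_of_prop36 S.Gc h36 S.chart).choose) (vH : Q.graph.V)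
    (hAb : Q.EdgeVerticialAbutment)
    (hvH : ∃ γ : (TemperedGraphGroupData.exists_completion_of_prop36 S.Gc h36 S.chart).choose,
      MulAut.conj γ • Q.vertGp vH = (TpH.map (TemperedGraphGroupData.exists_completion_of_prop36 S.Gc h36
        S.chart).choose_spec.choose.toMonoidHom).topologicalClosure)
    (hE : ∀ e : S.Gc.graph.Edge, ∀ L ∈ edgeLikeSubgroups S.chart e, ∃ e' : Q.graph.N ⊕ Q.graph.C,
      ∃ h : (TemperedGraphGroupData.exists_completion_of_prop36 S.Gc h36 S.chart).choose,
        L.map (TemperedGraphGroupData.exists_completion_of_prop36 S.Gc h36 S.chart).choose_spec.choose.toMonoidHom =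
          MulAut.conj h • Q.edgeGp e' ∧
        (Q.graph.Abuts e' vH → ∃ b : S.Gc.graph.Branch, S.Gc.graph.edgeOf b = e ∧
          ∃ w ∈ P.H.verts, S.Gc.graph.abuts b = some w))
    (hdict : ∀ x : {x : X.Pt // X.IsCusp x}, ∃ b : S.Gc.graph.Branch,
      S.Gc.graph.abuts b = some ((P.proj i).vertexMap (P.vtxOfCusp i x)) ∧
      (∀ b' : S.Gc.graph.Branch, S.Gc.graph.edgeOf b' = S.Gc.graph.edgeOf b →
        ∀ w : S.Gc.graph.Vertex, S.Gc.graph.abuts b' = some w → w = (P.proj i).vertexMap (P.vtxOfCusp i x)) ∧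
      ((X.inertia x.1).subgroupOf (X.toTemperedArithmeticGroup d).delta).map S.admissible.toMonoidHom ∈
        edgeLikeSubgroups S.chart (S.Gc.graph.edgeOf b)) :
    Literature.IUT.HodgeTheaters.StableCurveTemperedData.Cor23vi
        (ofSpecialFibre X d S h36 Sigma SigmaHat hsub hne hprime hp TpH ((TpH.map
          (TemperedGraphGroupData.exists_completion_of_prop36 S.Gc h36 S.chart).choose_spec.choose.toMonoidHom
          ).topologicalClosure) (Subgroup.le_topologicalClosure _)
          (fun x => (P.proj i).vertexMap (P.vtxOfCusp i x) ∈ P.H.verts)) :=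
  cor23vi_ofSpecialFibre_closureH_of_piData_of_hatEdgeIncidence X d S h36 Sigma SigmaHat hsub hne hprime hp TpH P i hTpH
    (hatEdgeIncidence_of_pscAbutment S.chart _ P.H TpH Q vH hAb hvH hE) hdict

end PiData

end StableCurveTemperedData

end Literature.IUT.HodgeTheaters

end
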